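import Summits.NavierStokesRegularity.FluidComputer.GateBudgetSwingLock
import HarnessLib

/-!
# GateBudget part 104 — the swing transfer, IV: the windows and the price (§284–§286)

Cell `pub-fluidc`, blueprint seat bp1 (gen 38, eighth item); namespace
`Summit.NavierStokesRegularity.FluidComputer.GateBudget`, headline family
`RotorKnob.rotorCircuit K K¹⁰ ε ρ` (modes `0 = a` carrier, `1 = b` clock, `2 = c` trigger,
`3 = d` transfer, `4 = ã` output) from `delayInit`, trigger primitive `C` (`C' = c`). Imports
part 103 (`GateBudgetSwingLock`: the headline band law; through it parts 99–102).
HONEST FRAMING: a low prior, high value-of-information experiment on Tao's machine paradigm;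
NOT a claim that NS blows up. Nothing here is about the Navier–Stokes equations.

THE POINT (SPEC-INPUT-bp1 §BV–§BZ, the swing law; sixth file). Part 103 §283 bounds the output
swing across the headline band `b ∈ [-(31/32)θε, (31/32)θε]` of one pulse (unit lattice
`ε = K¹⁰ρ²`, `θ ≥ 5/4`, `K ≥ 16`) by `COEF·PRICE`, `COEF ≤ (1 + 2/10⁴)·a(r)²/(θK⁹)` and
`PRICE = (cos²ψ₁ + cos²ψ₂) cos α₁ + (|sin 2ψ₁| + |sin 2ψ₂|)(1 - sin α₁) - (sin²ψ₁ + sin²ψ₂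
+ 2E₁)(log sin(α₁/2) - log cos(α₁/2))`, still symbolic in the edge angle
`α₁ = arccos((31/32)θε/R₂)` and the phase offsets `ψ₁ = Φ₁ - α₁`,
`ψ₂ = -(α₁ + Φ₁ + ε⁻¹K¹⁰(C(t₂) - C(t₁)))`. This file turns PRICE into a NUMBER.
(§284) With `y = cos α₁ ∈ [31/32, (31/32)(1 + 2/10⁵)]` the half-angle identities give
`log sin(α₁/2) - log cos(α₁/2) = -½ log((1 + y)/(1 - y)) ∈ [-3 log 2, 0]` (`(1 + y)/(1 - y)
≤ 64`), `sin α₁ = √(1 - y²) ≥ 0.2479`, and with `|sin ψᵢ| ≤ σᵢ`: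
`PRICE ≤ 2y + 1.5042(σ₁ + σ₂) + 2.0795(σ₁² + σ₂² + 2E₁)`.
(§285) THE WINDOWS: `arccos y ∈ [0.2499, 0.2510]` for `y ∈ [(31/32)(1 - 10⁻⁶),
(31/32)(1 + 2/10⁵)]` (Taylor bounds of `cos`); the climb phase `Φ₁ = (C(t₁) - C(r))/ρ²
∈ [0.2480, 0.2561]` from part 100's climb dose (`c(t₁) ∈ [0.24803, 0.24805]·θε` at the band
edge, `c(r) = ρ²/K⁹`); the band excess `δ = ε⁻¹K¹⁰(C(t₂) - C(t₁)) - (π - 2α₁)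
∈ [-0.0022, 0.0004]` from part 99's two angle laws (`κ = 0.9999` below, the wider ring
`R₁² = θ²ε² + 2ε²/10⁶` above). Hence `ψ₁ ∈ [-0.0030, 0.0062]`, `sin ψ₂ = sin(ψ₁ + δ)`,
`σ₁ = 0.0063`, `σ₂ = 0.0067`.
(§286) THE HEADLINE SWING PRICE: `ã(t₂) - ã(t₁) ≤ (1 + 2/10⁴)·(a(r)²/(θK⁹))·(1.96 + 4.16E)`,
`E` the crude-lock drift of part 103 §282 — against the crude `10/(3K⁹)` of part 75 §227
(`θ = 5/4`: `1.57·a(r)²/K⁹` versus `3.33/K⁹`).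

* §284 `swing_price_windows` (pure real analysis, displayed above).
* §285 `edge_angle_window` (`0.2499 ≤ arccos y ≤ 0.2510`); `climb_phase_window`
  (`0.2480 ≤ Φ₁ ≤ 0.2561`, from the dose sandwich of part 100 §277); `band_excess_window`
  (`-0.0022 ≤ δ ≤ 0.0004`, headline member on a symmetric band).
* §286 `swing_headline_price` (THE NUMBER; hypotheses = those of part 103 §283(b) plus
  `c(r) = ρ²/K⁹`, `T' - r ≤ 242/K⁹`, the dose sandwich at `t₁` — all from part 100 §277).

HONEST LIMITS. (i) `k = 1` (unit lattice) only, as parts 100–103; (ii) the drift `E` is left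
symbolic — on the ladder of part 97 it is `≤ 5·10⁻⁶` at `K = 16`, but that plumbing, the new
pulse ceiling `U₁ ≈ 1.57a(r)² + 0.19k² + …` replacing part 76's `7/2 + k²/3`, and the re-run
of the dud horizon (forecast `0.034K⁹ → 0.07K⁹` at `K = 16`) are parts 105–106 and remain a
FORECAST until filed; (iii) `1.96` has slack (true `≈ 1.9586`); (iv) nothing about NS.
[cite: Tao2016AveragedNS, §5.5 Theorem 5.3, (5.5), (b-eq), (c-eq), (d-eq), (ta-eq),
(energy-con)]
-/

noncomputable section

namespace Summit.NavierStokesRegularity.FluidComputer.GateBudget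

open Real Set Filter Topology
open Literature.Analysis.FluidPDE.Tao2016AveragedNS

variable {K M ε ρ : ℝ} {X : ℝ → Fin 5 → ℝ} {C : ℝ → ℝ}

/-! ## §284 The price on the windows -/

/-- §284 THE PRICE ON THE WINDOWS (pure real analysis): for an edge cosine
`y ∈ [31/32, (31/32)(1 + 2/10⁵)]`, `α₁ = arccos y`, offsets with `|sin ψᵢ| ≤ σᵢ` and a drift
`E₁ ≥ 0`, the price bracket of part 102 §281 is
`≤ 2y + (7521/5000)(σ₁ + σ₂) + (20795/10000)(σ₁² + σ₂² + 2E₁)` (`cos² ≤ 1`;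
`|sin 2ψ| ≤ 2|sin ψ|`, `1 - sin α₁ ≤ 1 - 0.2479`; `-(log sin(α₁/2) - log cos(α₁/2))
= ½ log((1 + y)/(1 - y)) ≤ 3 log 2 ≤ 2.0795`).
[derived: Mathlib (`Real.cos_arccos`, `Real.sin_arccos`, `Real.cos_sq`, `Real.log_two_lt_d9`)] -/
theorem swing_price_windows {y α₁ ψ₁ ψ₂ σ₁ σ₂ E₁ : ℝ} (hy1 : 31 / 32 ≤ y)
    (hy2 : y ≤ 31 / 32 * (1 + 2 / 10 ^ 5)) (hα₁ : α₁ = arccos y) (hσ₁ : |sin ψ₁| ≤ σ₁)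
    (hσ₂ : |sin ψ₂| ≤ σ₂) (hE₁ : 0 ≤ E₁) :
    (cos ψ₁ ^ 2 + cos ψ₂ ^ 2) * cos α₁ + (|sin (2 * ψ₁)| + |sin (2 * ψ₂)|) * (1 - sin α₁)
        - (sin ψ₁ ^ 2 + sin ψ₂ ^ 2 + 2 * E₁) * (log (sin (α₁ / 2)) - log (cos (α₁ / 2)))
      ≤ 2 * y + 7521 / 5000 * (σ₁ + σ₂) + 20795 / 10000 * (σ₁ ^ 2 + σ₂ ^ 2 + 2 * E₁) := by
  have hy0 : 0 ≤ y := by linarith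
  have hy3 : y < 1 := by linarith
  have hcos : cos α₁ = y := by rw [hα₁]; exact cos_arccos (by linarith) hy3.le
  have hsin : sin α₁ = √(1 - y ^ 2) := by rw [hα₁, sin_arccos]
  have hs1 : 2479 / 10000 ≤ sin α₁ := by
    rw [hsin]
    calc (2479 / 10000 : ℝ) = √((2479 / 10000) ^ 2) := (sqrt_sq (by norm_num)).symm
      _ ≤ √(1 - y ^ 2) := sqrt_le_sqrt (by nlinarith [mul_nonneg (sub_nonneg.2 hy2) hy0])
  have hs2 : sin α₁ ≤ 1 := sin_le_one _
  -- the cosine term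
  have h1 : (cos ψ₁ ^ 2 + cos ψ₂ ^ 2) * cos α₁ ≤ 2 * y := by
    rw [hcos]
    nlinarith [mul_nonneg (sub_nonneg.2 (cos_sq_le_one ψ₁)) hy0,
      mul_nonneg (sub_nonneg.2 (cos_sq_le_one ψ₂)) hy0]
  -- the double-angle term
  have hσ0 : 0 ≤ σ₁ := (abs_nonneg _).trans hσ₁
  have hσ0' : 0 ≤ σ₂ := (abs_nonneg _).trans hσ₂
  have h2a : ∀ {ψ σ : ℝ}, |sin ψ| ≤ σ → |sin (2 * ψ)| ≤ 2 * σ := by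
    intro ψ σ h
    rw [sin_two_mul, abs_mul, abs_mul, abs_two]
    have hm := mul_le_mul h (abs_cos_le_one ψ) (abs_nonneg _) ((abs_nonneg _).trans h)
    linarith
  have h2 : (|sin (2 * ψ₁)| + |sin (2 * ψ₂)|) * (1 - sin α₁) ≤ 7521 / 5000 * (σ₁ + σ₂) := by
    calc (|sin (2 * ψ₁)| + |sin (2 * ψ₂)|) * (1 - sin α₁)
        ≤ (2 * σ₁ + 2 * σ₂) * (7521 / 10000) :=
          mul_le_mul (add_le_add (h2a hσ₁) (h2a hσ₂)) (by linarith) (by linarith) (by linarith)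
      _ = 7521 / 5000 * (σ₁ + σ₂) := by ring
  -- the half-angle logarithm
  have hc2 : cos (α₁ / 2) ^ 2 = (1 + y) / 2 := by
    rw [cos_sq, show 2 * (α₁ / 2) = α₁ by ring, hcos]; ring
  have hs2' : sin (α₁ / 2) ^ 2 = (1 - y) / 2 := by rw [sin_sq, hc2]; ring
  have e1 : log ((1 - y) / 2) = 2 * log (sin (α₁ / 2)) := by
    rw [← hs2', Real.log_pow]; norm_num
  have e2 : log ((1 + y) / 2) = 2 * log (cos (α₁ / 2)) := by
    rw [← hc2, Real.log_pow]; norm_num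
  rw [Real.log_div (show (0 : ℝ) < 1 - y by linarith).ne' (by norm_num)] at e1
  rw [Real.log_div (show (0 : ℝ) < 1 + y by linarith).ne' (by norm_num)] at e2
  have hL : log (1 + y) - log (1 - y) ≤ 6 * log 2 := by
    rw [← Real.log_div (show (0 : ℝ) < 1 + y by linarith).ne'
      (show (0 : ℝ) < 1 - y by linarith).ne']
    have h64 : (1 + y) / (1 - y) ≤ 2 ^ 6 := by
      rw [div_le_iff₀ (by linarith)]; linarith
    calc log ((1 + y) / (1 - y)) ≤ log (2 ^ 6) :=
          Real.log_le_log (div_pos (by linarith) (by linarith)) h64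
      _ = 6 * log 2 := by rw [Real.log_pow]; norm_num
  have hL0 : 0 ≤ log (1 + y) - log (1 - y) := by
    rw [← Real.log_div (show (0 : ℝ) < 1 + y by linarith).ne'
      (show (0 : ℝ) < 1 - y by linarith).ne']
    exact Real.log_nonneg (by rw [le_div_iff₀ (by linarith)]; linarith)
  have hS : sin ψ₁ ^ 2 + sin ψ₂ ^ 2 + 2 * E₁ ≤ σ₁ ^ 2 + σ₂ ^ 2 + 2 * E₁ := by
    have a1 : sin ψ₁ ^ 2 ≤ σ₁ ^ 2 := by
      rw [← sq_abs (sin ψ₁)]; exact pow_le_pow_left₀ (abs_nonneg _) hσ₁ 2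
    have a2 : sin ψ₂ ^ 2 ≤ σ₂ ^ 2 := by
      rw [← sq_abs (sin ψ₂)]; exact pow_le_pow_left₀ (abs_nonneg _) hσ₂ 2
    linarith
  have hlog2 := Real.log_two_lt_d9
  have h3 : -((sin ψ₁ ^ 2 + sin ψ₂ ^ 2 + 2 * E₁) * (log (sin (α₁ / 2)) - log (cos (α₁ / 2))))
      ≤ 20795 / 10000 * (σ₁ ^ 2 + σ₂ ^ 2 + 2 * E₁) := by
    have hℓ : log (sin (α₁ / 2)) - log (cos (α₁ / 2)) = -((log (1 + y) - log (1 - y)) / 2) := by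
      linarith
    rw [hℓ, mul_neg, neg_neg]
    calc (sin ψ₁ ^ 2 + sin ψ₂ ^ 2 + 2 * E₁) * ((log (1 + y) - log (1 - y)) / 2)
        ≤ (σ₁ ^ 2 + σ₂ ^ 2 + 2 * E₁) * (20795 / 10000) :=
          mul_le_mul hS (by linarith) (by linarith) (by positivity)
      _ = 20795 / 10000 * (σ₁ ^ 2 + σ₂ ^ 2 + 2 * E₁) := by ring
  linarith [h1, h2, h3]

/-! ## §285 The windows -/

/-- §285(a) THE EDGE ANGLE WINDOW: `0.2499 ≤ arccos y ≤ 0.2510` for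
`(31/32)(1 - 10⁻⁶) ≤ y ≤ (31/32)(1 + 2/10⁵)` (`1 - x²/2 ≤ cos x ≤ 1 - x²/2 + 5x⁴/96`, `arccos`
antitone; covers both `arccos((31/32)θε/R₂)` and `arccos((31/32)θε/R₁)`).
[derived: Mathlib (`Real.one_sub_sq_div_two_le_cos`, `Real.cos_bound`, `Real.arccos_cos`)] -/
theorem edge_angle_window {y : ℝ} (h1 : 31 / 32 * (1 - 1 / 10 ^ 6) ≤ y)
    (h2 : y ≤ 31 / 32 * (1 + 2 / 10 ^ 5)) :
    2499 / 10000 ≤ arccos y ∧ arccos y ≤ 251 / 1000 := by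
  have hπ := Real.pi_gt_three
  constructor
  · have hc : y ≤ cos (2499 / 10000) := by
      have h := Real.one_sub_sq_div_two_le_cos (x := (2499 / 10000 : ℝ))
      linarith
    calc (2499 / 10000 : ℝ) = arccos (cos (2499 / 10000)) :=
          (arccos_cos (by norm_num) (by linarith)).symm
      _ ≤ arccos y := arccos_le_arccos hc
  · have hc : cos (251 / 1000) ≤ y := by
      have hb := Real.cos_bound (x := (251 / 1000 : ℝ)) (by norm_num)
      have h := (abs_le.1 hb).2
      norm_num at h
      linarith
    calc arccos y ≤ arccos (cos (251 / 1000)) := arccos_le_arccos hc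
      _ = 251 / 1000 := arccos_cos (by norm_num) (by linarith)

/-- §285(b) THE CLIMB PHASE WINDOW (headline member, unit lattice `ε = K¹⁰ρ²`, `K ≥ 16`,
`ε > 0`, `θ ≥ 5/4`; a pulse start `r ≤ t₁` with `t₁ - r ≤ 242/K⁹`, `c(r) = ρ²/K⁹`, the band
edge `b(t₁) = (31/32)θε` on the kept ring with `c(t₁) > 0`, and part 100 §277's dose sandwich
`(31/32)θK¹⁰(C(t₁) - C(r)) ≤ c(t₁) - c(r) ≤ (1 + 10⁻⁴)θK¹⁰(C(t₁) - C(r)) + ρ²e^{-K¹⁰}(t₁ - r)`):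
`0.2480 ≤ (C(t₁) - C(r))/ρ² ≤ 0.2561` (`c(t₁) ∈ [0.24803, 0.24805]·θε`,
`K¹⁰(C(t₁) - C(r)) = ε·(C(t₁) - C(r))/ρ²`, `c(r), ρ²(t₁ - r) ≤ ε/10¹²`).
[derived: part 100 §277 (hypotheses); numerics] -/
theorem climb_phase_window (hK : 16 ≤ K) (hε : 0 < ε) (hlat : ε = K ^ 10 * ρ ^ 2)
    {r t₁ θ : ℝ} (hθ1 : 5 / 4 ≤ θ) (hrt : r ≤ t₁) (hτ : t₁ - r ≤ 242 / K ^ 9)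
    (hb1 : X t₁ 1 = 31 / 32 * θ * ε) (hcr : X r 2 = ρ ^ 2 / K ^ 9)
    (hring1 : θ ^ 2 * ε ^ 2 - ε ^ 2 / 10 ^ 6 ≤ X t₁ 1 ^ 2 + X t₁ 2 ^ 2 ∧
      X t₁ 1 ^ 2 + X t₁ 2 ^ 2 ≤ θ ^ 2 * ε ^ 2 + 2 * ε ^ 2 / 10 ^ 6)
    (hc1 : 0 < X t₁ 2) (hdlo : 31 / 32 * θ * K ^ 10 * (C t₁ - C r) ≤ X t₁ 2 - X r 2)
    (hdhi : X t₁ 2 - X r 2 ≤ (1 + 1 / 10 ^ 4) * θ * K ^ 10 * (C t₁ - C r)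
      + ρ ^ 2 * exp (-K ^ 10) * (t₁ - r)) :
    2480 / 10000 ≤ (C t₁ - C r) / ρ ^ 2 ∧ (C t₁ - C r) / ρ ^ 2 ≤ 2561 / 10000 := by
  have hK0 : (0 : ℝ) < K := by linarith
  have hM : (0 : ℝ) < K ^ 10 := by positivity
  have hρ2 : ρ ^ 2 = ε / K ^ 10 := by rw [eq_div_iff hM.ne', hlat]; ring
  have hρ0 : 0 < ρ ^ 2 := by rw [hρ2]; positivity
  obtain ⟨Φ, hΦ⟩ : ∃ Φ : ℝ, Φ = (C t₁ - C r) / ρ ^ 2 := ⟨_, rfl⟩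
  have hΦ1 : ρ ^ 2 * Φ = C t₁ - C r := by rw [hΦ, mul_div_cancel₀ _ hρ0.ne']
  have hKC : K ^ 10 * (C t₁ - C r) = ε * Φ := by rw [← hΦ1, hlat]; ring
  rw [← hΦ]
  have hθ0 : 0 < θ := by linarith
  have hθε : 0 < θ * ε := mul_pos hθ0 hε
  have he2 : 0 < ε ^ 2 := by positivity
  have hθsq : (5 / 4 : ℝ) ^ 2 ≤ θ ^ 2 := pow_le_pow_left₀ (by norm_num) hθ1 2
  have hθe : 25 / 16 * ε ^ 2 ≤ θ ^ 2 * ε ^ 2 := by nlinarith only [hθsq, he2]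
  have hme : (θ * ε) ^ 2 = θ ^ 2 * ε ^ 2 := mul_pow θ ε 2
  have hb1sq : X t₁ 1 ^ 2 = (31 / 32) ^ 2 * (θ ^ 2 * ε ^ 2) := by rw [hb1]; ring
  -- the trigger at the band edge
  have hclo : 24803 / 100000 * (θ * ε) ≤ X t₁ 2 := by
    have h : (24803 / 100000 * (θ * ε)) ^ 2 ≤ X t₁ 2 ^ 2 := by
      rw [mul_pow, hme]; linarith only [hring1.1, hb1sq, hθe, he2]
    exact (abs_le_of_sq_le_sq' h hc1.le).2
  have hchi : X t₁ 2 ≤ 24805 / 100000 * (θ * ε) := by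
    have h : X t₁ 2 ^ 2 ≤ (24805 / 100000 * (θ * ε)) ^ 2 := by
      rw [mul_pow, hme]; linarith only [hring1.2, hb1sq, hθe, he2]
    exact (abs_le_of_sq_le_sq' h (by positivity)).2
  -- the small terms
  have hK9 : (242 : ℝ) ≤ K ^ 9 := le_trans (by norm_num) (pow_le_pow_left₀ (by norm_num) hK 9)
  have hK10 : (10 : ℝ) ^ 12 ≤ K ^ 10 := by
    have h : (16 : ℝ) ^ 10 ≤ K ^ 10 := pow_le_pow_left₀ (by norm_num) hK 10
    nlinarith only [h]
  have hρε : ρ ^ 2 ≤ ε / 10 ^ 12 := by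
    rw [hρ2]; exact div_le_div_of_nonneg_left hε.le (by norm_num) hK10
  have hcr0 : 0 ≤ X r 2 := by rw [hcr]; positivity
  have hcrhi : X r 2 ≤ ε / 10 ^ 12 := by
    rw [hcr]; exact (div_le_self hρ0.le (le_trans (by norm_num) hK9)).trans hρε
  have htail : ρ ^ 2 * exp (-K ^ 10) * (t₁ - r) ≤ ε / 10 ^ 12 := by
    have h1 : exp (-K ^ 10) ≤ 1 := Real.exp_le_one_iff.2 (by linarith only [hM])
    have h2 : t₁ - r ≤ 1 := hτ.trans ((div_le_one (by positivity)).2 hK9)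
    have h3 : 0 ≤ t₁ - r := by linarith
    calc ρ ^ 2 * exp (-K ^ 10) * (t₁ - r) ≤ ρ ^ 2 * 1 * 1 :=
          mul_le_mul (mul_le_mul_of_nonneg_left h1 hρ0.le) h2 h3 (by positivity)
      _ ≤ ε / 10 ^ 12 := by rw [mul_one, mul_one]; exact hρε
  have hεθ : ε ≤ 4 / 5 * (θ * ε) := by nlinarith only [hθ1, hε]
  have hdlo' : 31 / 32 * θ * (ε * Φ) ≤ X t₁ 2 - X r 2 := by
    rw [← hKC]; linarith only [hdlo]
  have hdhi' : X t₁ 2 - X r 2 ≤ (1 + 1 / 10 ^ 4) * θ * (ε * Φ)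
      + ρ ^ 2 * exp (-K ^ 10) * (t₁ - r) := by
    rw [← hKC]; linarith only [hdhi]
  constructor
  · have key : 2480 / 10000 * (θ * ε) ≤ Φ * (θ * ε) := by
      linarith only [hdhi', hclo, hcrhi, htail, hεθ, hθε]
    exact le_of_mul_le_mul_right key hθε
  · have key : Φ * (θ * ε) ≤ 2561 / 10000 * (θ * ε) := by
      linarith only [hdlo', hchi, hcr0, hθε]
    exact le_of_mul_le_mul_right key hθε

/-- §285(c) THE BAND EXCESS WINDOW (headline member `K ≥ 16`, `ε > 0`, `θ ≥ 5/4`; a symmetric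
band `t₁ ≤ t₂`, `b(t₁) = (31/32)θε = -b(t₂)`, `|b| ≤ (31/32)θε`, kept ring
`θ²ε² - ε²/10⁶ ≤ b² + c² ≤ θ²ε² + 2ε²/10⁶` and `c > 0` on `[t₁, t₂]`;
`R₂ = √(θ²ε² - ε²/10⁶ - ε²/K¹⁰)`, `α₁ = arccos((31/32)θε/R₂)`): the band dose exceeds the
geometric angle `π - 2α₁` by `δ = ε⁻¹K¹⁰(C(t₂) - C(t₁)) - (π - 2α₁) ∈ [-0.0022, 0.0004]`
(below: part 99 §274 with `κ = 0.9999` gives `κ·dose ≤ π - 2α₁`, `π < 3.15`; above: part 99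
§275 on the ring `R₁² = θ²ε² + 2ε²/10⁶` gives `π - 2 arccos((31/32)θε/R₁) ≤ dose`, and both
angles lie in the window of §285(a)).
[derived: part 99 §274–§276; part 103 §283(a),(c); this file §285(a)] -/
theorem band_excess_window
    (hX : ∀ t, HasDerivAt X (RotorKnob.rotorCircuit K (K ^ 10) ε ρ (X t)) t)
    (h0 : X 0 = delayInit) (hC : ∀ t, HasDerivAt C (X t 2) t) (hK : 16 ≤ K) (hε : 0 < ε)
    {t₁ t₂ θ : ℝ} (ht : t₁ ≤ t₂) (hθ1 : 5 / 4 ≤ θ)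
    (hring : ∀ u ∈ Icc t₁ t₂, θ ^ 2 * ε ^ 2 - ε ^ 2 / 10 ^ 6 ≤ X u 1 ^ 2 + X u 2 ^ 2 ∧
      X u 1 ^ 2 + X u 2 ^ 2 ≤ θ ^ 2 * ε ^ 2 + 2 * ε ^ 2 / 10 ^ 6)
    (hpos : ∀ u ∈ Icc t₁ t₂, 0 < X u 2) (hb1 : X t₁ 1 = 31 / 32 * θ * ε)
    (hb2 : X t₂ 1 = -(31 / 32 * θ * ε))
    (hband : ∀ u ∈ Icc t₁ t₂, -(31 / 32 * θ * ε) ≤ X u 1 ∧ X u 1 ≤ 31 / 32 * θ * ε)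
    {R₂ α₁ : ℝ} (hR₂ : R₂ = √(θ ^ 2 * ε ^ 2 - ε ^ 2 / 10 ^ 6 - ε ^ 2 / K ^ 10))
    (hα₁ : α₁ = arccos (31 / 32 * θ * ε / R₂)) :
    -(22 / 10000) ≤ ε⁻¹ * K ^ 10 * (C t₂ - C t₁) - (π - 2 * α₁) ∧
      ε⁻¹ * K ^ 10 * (C t₂ - C t₁) - (π - 2 * α₁) ≤ 4 / 10000 := by
  have hK0 : (0 : ℝ) < K := by linarith
  have hM : (0 : ℝ) < K ^ 10 := by positivity
  obtain ⟨hRpos, hRQ, hRlo2, hRband, -, -⟩ := headline_band_radius hK hε hθ1 hR₂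
  obtain ⟨-, hy1, hy2⟩ := swing_coef_headline hK hε hθ1 (le_refl (0 : ℝ)) hR₂
  have hθ0 : 0 < θ := by linarith
  have hθε : 0 < θ * ε := mul_pos hθ0 hε
  -- the lower angle law of part 99 on `[t₁, t₂]` (hypotheses as in part 103 §283(b))
  have hbsq : ∀ u ∈ Icc t₁ t₂, X u 1 ^ 2 ≤ (31 / 32 * θ * ε) ^ 2 := fun u hu =>
    sq_le_sq' (hband u hu).1 (hband u hu).2
  have hband2 : ∀ u ∈ Icc t₁ t₂, X u 1 ^ 2 < R₂ ^ 2 := fun u hu => (hbsq u hu).trans_lt hRband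
  have hκ : ∀ u ∈ Icc t₁ t₂, 9999 / 10000 * X u 2 ≤ √(R₂ ^ 2 - X u 1 ^ 2) := by
    intro u hu
    refine band_kappa_headline hθ1 hε hRlo2 ?_ ?_
    · rw [← mul_pow, ← mul_assoc]; exact hbsq u hu
    · rw [mul_pow]; exact (hring u hu).2
  have hlow := clock_angle_lower hX h0 hC hε hM ht hRpos hRQ.le (fun u hu => (hring u hu).1)
    hband2 hκ
  have hys : X t₂ 1 / R₂ = -(31 / 32 * θ * ε / R₂) := by rw [hb2, neg_div]
  rw [hys, hb1, arccos_neg, ← hα₁] at hlow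
  -- the upper angle law of part 99 on the wider ring
  obtain ⟨R₁, hR₁⟩ : ∃ R₁ : ℝ, R₁ = √(θ ^ 2 * ε ^ 2 + 2 * ε ^ 2 / 10 ^ 6) := ⟨_, rfl⟩
  have hR1sq : R₁ ^ 2 = θ ^ 2 * ε ^ 2 + 2 * ε ^ 2 / 10 ^ 6 := by
    rw [hR₁, sq_sqrt (by positivity)]
  have hR1pos : 0 < R₁ := by rw [hR₁]; exact sqrt_pos.2 (by positivity)
  have hringU : ∀ u ∈ Icc t₁ t₂, X u 1 ^ 2 + X u 2 ^ 2 ≤ R₁ ^ 2 := fun u hu => by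
    rw [hR1sq]; exact (hring u hu).2
  have hup := clock_angle_upper hX hC hε hM.le ht hR1pos hringU hpos
  have hys' : X t₂ 1 / R₁ = -(31 / 32 * θ * ε / R₁) := by rw [hb2, neg_div]
  rw [hys', hb1, arccos_neg] at hup
  -- both edge cosines lie in the window of §285(a)
  have he2 : 0 < ε ^ 2 := by positivity
  have hθsq : (5 / 4 : ℝ) ^ 2 ≤ θ ^ 2 := pow_le_pow_left₀ (by norm_num) hθ1 2
  have hθe : 25 / 16 * ε ^ 2 ≤ θ ^ 2 * ε ^ 2 := by nlinarith only [hθsq, he2]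
  have hme : (θ * ε) ^ 2 = θ ^ 2 * ε ^ 2 := mul_pow θ ε 2
  have hR1hi : (1 - 1 / 10 ^ 6) * R₁ ≤ θ * ε := by
    have h : ((1 - 1 / 10 ^ 6) * R₁) ^ 2 ≤ (θ * ε) ^ 2 := by
      rw [mul_pow, hR1sq, hme]; linarith only [hθe, he2]
    exact (abs_le_of_sq_le_sq' h hθε.le).2
  have hR1lo : θ * ε ≤ R₁ := by
    have h : (θ * ε) ^ 2 ≤ R₁ ^ 2 := by rw [hR1sq, hme]; linarith only [he2]
    exact (abs_le_of_sq_le_sq' h hR1pos.le).2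
  have hy1' : 31 / 32 * (1 - 1 / 10 ^ 6) ≤ 31 / 32 * θ * ε / R₁ := by
    rw [le_div_iff₀ hR1pos]; linarith only [hR1hi]
  have hy2' : 31 / 32 * θ * ε / R₁ ≤ 31 / 32 * (1 + 2 / 10 ^ 5) := by
    rw [div_le_iff₀ hR1pos]; nlinarith only [hR1lo, hθε]
  obtain ⟨hα1, -⟩ := edge_angle_window (by linarith only [hy1]) hy2
  obtain ⟨-, hα2'⟩ := edge_angle_window hy1' hy2'
  rw [← hα₁] at hα1
  have hπ := Real.pi_lt_d2
  have hα0 : 0 ≤ α₁ := by rw [hα₁]; exact arccos_nonneg _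
  constructor
  · linarith only [hup, hα1, hα2']
  · linarith only [hlow, hα0, hπ]

/-! ## §286 The headline swing price -/

/-- §286 THE HEADLINE SWING PRICE (headline member `K ≥ 16`, `ε > 0`, UNIT LATTICE
`ε = K¹⁰ρ²`, `θ ≥ 5/4`; a pulse start `r ≥ 0` with `c(r) = ρ²/K⁹`, an end `T' ≤ r + 242/K⁹`,
the kept ring `θ²ε² - ε²/10⁶ ≤ b² + c² ≤ θ²ε² + 2ε²/10⁶` and `c > 0` on `[r, T']`,
`a(r) ≠ 0`; the symmetric band `r ≤ t₁ ≤ t₂ ≤ T'`, `b(t₁) = (31/32)θε = -b(t₂)`,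
`|b| ≤ (31/32)θε` on `[t₁, t₂]`, and the dose sandwich at `t₁` — part 100 §277
`pulse_swing_band` supplies all of it; `E = (|d(r)| + d(r)² + 6(ε + ρ²e^{-K¹⁰}
+ Kã(T'))(T' - r))/a(r)²`): `ã(t₂) - ã(t₁) ≤ (1 + 2/10⁴)·a(r)²/(θK⁹)·(1.96 + 4.16E)`.
[derived: part 103 §283(b),(c); this file §284, §285] -/
theorem swing_headline_price
    (hX : ∀ t, HasDerivAt X (RotorKnob.rotorCircuit K (K ^ 10) ε ρ (X t)) t)
    (h0 : X 0 = delayInit) (hC : ∀ t, HasDerivAt C (X t 2) t) (hK : 16 ≤ K) (hε : 0 < ε)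
    (hlat : ε = K ^ 10 * ρ ^ 2) {r t₁ t₂ T' θ : ℝ} (hr : 0 ≤ r) (hrt : r ≤ t₁) (ht : t₁ ≤ t₂)
    (htT : t₂ ≤ T') (hτ : T' - r ≤ 242 / K ^ 9) (hθ1 : 5 / 4 ≤ θ) (ha : X r 0 ≠ 0)
    (hcr : X r 2 = ρ ^ 2 / K ^ 9)
    (hring : ∀ u ∈ Icc r T', θ ^ 2 * ε ^ 2 - ε ^ 2 / 10 ^ 6 ≤ X u 1 ^ 2 + X u 2 ^ 2 ∧
      X u 1 ^ 2 + X u 2 ^ 2 ≤ θ ^ 2 * ε ^ 2 + 2 * ε ^ 2 / 10 ^ 6)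
    (hpos : ∀ u ∈ Icc r T', 0 < X u 2) (hb1 : X t₁ 1 = 31 / 32 * θ * ε)
    (hb2 : X t₂ 1 = -(31 / 32 * θ * ε))
    (hband : ∀ u ∈ Icc t₁ t₂, -(31 / 32 * θ * ε) ≤ X u 1 ∧ X u 1 ≤ 31 / 32 * θ * ε)
    (hdlo : 31 / 32 * θ * K ^ 10 * (C t₁ - C r) ≤ X t₁ 2 - X r 2)
    (hdhi : X t₁ 2 - X r 2 ≤ (1 + 1 / 10 ^ 4) * θ * K ^ 10 * (C t₁ - C r)
      + ρ ^ 2 * exp (-K ^ 10) * (t₁ - r)) {E : ℝ}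
    (hE : E = (|X r 3| + X r 3 ^ 2 + 6 * (ε + ρ ^ 2 * exp (-K ^ 10) + K * X T' 4) * (T' - r))
      / X r 0 ^ 2) :
    X t₂ 4 - X t₁ 4 ≤ (1 + 2 / 10 ^ 4) * X r 0 ^ 2 / (θ * K ^ 9) * (196 / 100 + 416 / 100 * E) := by
  have hK0 : (0 : ℝ) < K := by linarith
  obtain ⟨R₂, hR₂⟩ : ∃ R₂ : ℝ, R₂ = √(θ ^ 2 * ε ^ 2 - ε ^ 2 / 10 ^ 6 - ε ^ 2 / K ^ 10) :=
    ⟨_, rfl⟩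
  obtain ⟨α₁, hα₁⟩ : ∃ α₁ : ℝ, α₁ = arccos (31 / 32 * θ * ε / R₂) := ⟨_, rfl⟩
  obtain ⟨ψ₁, hψ₁⟩ : ∃ ψ₁ : ℝ, ψ₁ = (C t₁ - C r) / ρ ^ 2 - α₁ := ⟨_, rfl⟩
  obtain ⟨ψ₂, hψ₂⟩ : ∃ ψ₂ : ℝ,
      ψ₂ = -(α₁ + (C t₁ - C r) / ρ ^ 2 + ε⁻¹ * K ^ 10 * (C t₂ - C t₁)) := ⟨_, rfl⟩
  have h9 : ((9999 / 10000 : ℝ)⁻¹ - 1) = 1 / 9999 := by norm_num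
  obtain ⟨E₁, hE₁⟩ : ∃ E₁ : ℝ, E₁ = E + π * ((9999 / 10000 : ℝ)⁻¹ - 1) := ⟨_, rfl⟩
  have hmain := swing_band_headline hX h0 hC hK hε hlat hr hrt ht htT hθ1 ha hring hpos hb1 hb2
    hband hR₂ hE hα₁ hψ₁ hψ₂ hE₁
  obtain ⟨hRpos, -⟩ := headline_band_radius hK hε hθ1 hR₂
  obtain ⟨hcoef, hy1, hy2⟩ := swing_coef_headline hK hε hθ1 (sq_nonneg (X r 0)) hR₂
  -- the windows
  have hsub1 : t₁ ∈ Icc r T' := ⟨hrt, ht.trans htT⟩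
  have hsubI : ∀ u ∈ Icc t₁ t₂, u ∈ Icc r T' := fun u hu => ⟨hrt.trans hu.1, hu.2.trans htT⟩
  obtain ⟨hΦ1, hΦ2⟩ := climb_phase_window hK hε hlat hθ1 hrt (by linarith only [hτ, hsub1.2])
    hb1 hcr (hring t₁ hsub1) (hpos t₁ hsub1) hdlo hdhi
  obtain ⟨hαlo, hαhi⟩ := edge_angle_window (by linarith only [hy1]) hy2
  rw [← hα₁] at hαlo hαhi
  obtain ⟨hδ1, hδ2⟩ := band_excess_window hX h0 hC hK hε ht hθ1 (fun u hu => hring u (hsubI u hu))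
    (fun u hu => hpos u (hsubI u hu)) hb1 hb2 hband hR₂ hα₁
  -- the phase offsets
  have hψlo : -(30 / 10000) ≤ ψ₁ := by rw [hψ₁]; linarith only [hΦ1, hαhi]
  have hψhi : ψ₁ ≤ 62 / 10000 := by rw [hψ₁]; linarith only [hΦ2, hαlo]
  have hσ₁ : |sin ψ₁| ≤ 63 / 10000 :=
    abs_sin_le_abs.trans (abs_le.2 ⟨by linarith only [hψlo], by linarith only [hψhi]⟩)
  have hsin2 : sin ψ₂ = sin (ψ₁ + (ε⁻¹ * K ^ 10 * (C t₂ - C t₁) - (π - 2 * α₁))) := by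
    have e : ψ₂ = -((ψ₁ + (ε⁻¹ * K ^ 10 * (C t₂ - C t₁) - (π - 2 * α₁))) + π) := by
      rw [hψ₂, hψ₁]; ring
    rw [e, sin_neg, sin_add_pi, neg_neg]
  have hσ₂ : |sin ψ₂| ≤ 67 / 10000 := by
    rw [hsin2]
    exact abs_sin_le_abs.trans (abs_le.2 ⟨by linarith only [hψlo, hδ1],
      by linarith only [hψhi, hδ2]⟩)
  -- the drift is nonnegative
  have hE0 : 0 ≤ E := by
    rw [hE]
    have hT0 : 0 ≤ T' := hr.trans (hrt.trans (ht.trans htT))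
    have he := RotorKnob.e_nonneg hX h0 hK0.le hT0
    have hτ0 : 0 ≤ T' - r := by linarith only [hrt, ht, htT]
    positivity
  rw [h9] at hE₁
  have hE₁0 : 0 ≤ E₁ := by rw [hE₁]; positivity
  have hprice := swing_price_windows hy1 hy2 hα₁ hσ₁ hσ₂ hE₁0
  have hπ := Real.pi_lt_d2
  have hB : 2 * (31 / 32 * θ * ε / R₂) + 7521 / 5000 * (63 / 10000 + 67 / 10000)
      + 20795 / 10000 * ((63 / 10000) ^ 2 + (67 / 10000) ^ 2 + 2 * E₁)
      ≤ 196 / 100 + 416 / 100 * E := by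
    rw [hE₁]; linarith only [hy2, hπ, hE0]
  have hc0 : 0 ≤ K * X r 0 ^ 2 / (ε⁻¹ * K ^ 10 * (9999 / 10000) * R₂) := by positivity
  refine hmain.trans ((mul_le_mul_of_nonneg_left (hprice.trans hB) hc0).trans ?_)
  exact mul_le_mul_of_nonneg_right hcoef (by positivity)

end Summit.NavierStokesRegularity.FluidComputer.GateBudget
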